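import Summits.AtomisticToContinuum.BoseEinsteinCondensation.Theses.BECInfraredBound
import Literature.MathematicalPhysics.QuantumManyBody.BoseGasSlabDepletion
import Literature.MathematicalPhysics.QuantumManyBody.BoseGasSlabDepletionFree
import Literature.MathematicalPhysics.QuantumManyBody.DiluteBoseGasUpperBoundLocalization
import Literature.MathematicalPhysics.QuantumManyBody.PeriodicBoseGasScattering
import Literature.MathematicalPhysics.QuantumManyBody.LiebYngvasonTheorem

/-!
# Line `ruelle-bracketing` — crux `BecShellMass` (stmt-AtomisticToContinuum-0734), route `BECInfraredBound`
# file `Cruxes/BecShellMass/Lines/ruelle_bracketing.lean` (crux-strategist s2, 2026-08-17)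

STATUS 2026-08-17T19:10Z: **UNREGISTERED alternative line.** The crux CLOSED (`closed_as: proved`,
`Summit.AtomisticToContinuum.BoseEinsteinCondensation.Theorems.becShellMass_proof`, p173018, lead line `Sketch`)
while this file was being kernel-checked; `ledger skeleton check` was deliberately NOT run, so the three
`stub_*` below are not registered stubs of the item.  The file is kept in the crux workfiles because its
composition also proves the STRENGTHENING `becShellMass_uniform` (density threshold `ρ₀` independent of `ε`,
recorded OPEN in `Disproof.lean` §3) from the same three stubs — bank it if a route ever wants uniformity.
`lean check` rc 0, sorries = 3 (exactly the stubs), 2026-08-17T19:08Z.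

The crux (by name, `Summit.AtomisticToContinuum.BoseEinsteinCondensation.Theses.BECInfraredBound.BecShellMass`):
NO BOUNDARY ACCUMULATION — for every repulsive finite-range `v` there is `C` such that for every
`ε ∈ (0, 1/4)`, some `ρ₀ > 0`, all `0 < ρ < ρ₀`, all large `N`, some `δ > 0` and every Dirichlet
`δ`-near-minimiser `Ψ` in the box of side `L = (N/ρ)^{1/3}`, the expected number of particles in the
shell `Λ_L ∖ (εL, L−εL)³` is `≤ C ε N`.

## The line: MACROSCOPIC NEUMANN BRACKETING OF ONE FACE LAYER + RUELLE'S TANGENT IN THE BULK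

Idea card `Ideas/bulk-tangent-bracketing.md`.  The shell is covered by the six face slabs of width
`s = 2εL`; low slabs are top slabs of the reflected state (`stub_reflect`), so fix a direction `a` and the
top slab `{x_a > L - s}`.  Re-run the tree's slab bracketing (`BoseGas.slab_le_of_bracketing`, which is
the `s ≤ 1`, linear-penalty version) at the MACROSCOPIC layer scale: Neumann cells of side
`ℓ ∈ [ℓ₀, 2ℓ₀]`, `ℓ₀ = s + δ_r` with ramp `δ_r = εL/2`, so only `K = L/ℓ ≤ 1/(2.5 ε)` cells per axis; the
IMS profile pair across the ramp costs `N (π²/(4δ_r))² = O(N/(εL)²) = o(N)`; the bulk piece with `N - m`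
particles is bounded below by RUELLE'S SUPPORTING LINE `N e(ρ⋆) − m S` of the convex thermodynamic energy
density (`BoseGas.ofReal_tangent_le_groundStateEnergy`, slope `S ≤ 2e(2ρ) ≤ 16πaρ(1+C_u) = πaρC′`,
`C′ = 16(1+C_u)`, by Dyson's upper bound `eventually_groundStateEnergy_le_dyson`); the `K²` top cells holding the `m` slab particles are bounded below by a CONVEX floor
`g(n) ≤ E₀^Neu(n, ℓ)` and two Jensen steps (over the top cells, then over the IMS weights) give the budget
inequality `K² g(m̄/K²) − m̄ S ≤ E₁ + N(π²/(4δ_r))²` for the mean slab occupation `m̄ ≥ slab mass`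
(`stub_convexBracketing`).  With the QUADRATIC Lieb–Yngvason floor
`g(t) = (2πa/ℓ³)·min(t,T)(2t − min(t,T)) − A`, `T = ρ₁ℓ³` (`stub_quadraticCellFloor`: LY Thm 2.4 in
Neumann cells with `(1 − CY^{1/17}) ≥ 1/2` up to the dilute threshold, superadditivity above it, a constant
`A` below the size threshold), the budget is a convex function of `m̄` vanishing at `0`, and evaluating it
at `t⋆ = C′N/K` exceeds the budget as soon as `ρ ≤ ρ₁/C′` and `N` is large (`interacting_budget`,
`lt_of_budget`): `m̄ < t⋆ ≤ 5C′εN`.  Six faces: `C = 30 C′` (the bound is the trivial `≤ N` when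
`30C′ε ≥ 1`, `shellBound_of_one_le`).  BY-PRODUCT (`becShellMass_uniform`): `ρ₀` does NOT depend
on `ε` — the strengthening `∃ C ρ₀, ∀ ε …` recorded OPEN in `Disproof.lean` §3 is what this line proves.

Free branch (`a = 0`): `v ∘ ‖·‖ = 0` a.e. (`LSSY2005_zeroScatteringLength_holds`), the energy is kinetic,
`E₀ ≤ 3N(π/L)²(1+ε)` for large `L` (`groundStateEnergy_zero_le_of_ge`) and the tree's
`slab_le_of_kinetic_excess` bounds each top slab by `(32π²ε³/3 + 2ε)N + 2L²/(3π²) ≤ 16εN` eventually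
(`free_arith`), so `C = 100` (`shellBound_free`).

Composition: `becShellMass_of_stubs : Stmt.stub_reflect → Stmt.stub_quadraticCellFloor →
Stmt.stub_convexBracketing → BecShellMass` (kernel-checked) and `BecShellMass_of : BECInfraredBound.BecShellMass`
— the crux BY NAME from the three stubs.

Disproof used (`Cruxes/BecShellMass/Disproof.lean`, cdisprove 2026-08-17, VERDICT NO KILL): the three
load-bearing hypotheses are all consumed — `becShellMass_false_without_nearMin` (H = near-minimality: used in
the budget `E₁ = 2ε₁N + 1`, `δ := 1`), `becShellMass_false_without_finiteRange` (H = finite range: gives the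
range `R`, `a < ∞`, the subcritical cap and Ruelle's limit), `becShellMass_false_at_all_densities` (H = low
density: `ρ ≤ ρ₁/C′` keeps `t⋆/K²` inside the quadratic regime of the LY floor).  No stub is an instance of the
landed `Theorems/BecShellMass/Negative/LoadBearingHypotheses.lean` lemmas (each stub keeps all three H's or is
a statement about a single trial state).
-/

noncomputable section

namespace Summit.AtomisticToContinuum.BoseEinsteinCondensation.Cruxes.BecShellMass.RuelleBracketing

open Literature.MathematicalPhysics.QuantumManyBody.BoseGas
open _root_.MeasureTheory _root_.Filter
open scoped ENNReal Topology
open Summit.AtomisticToContinuum.BoseEinsteinCondensation.Theses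

/-! ### Stub statements (namespace `Stmt`) -/

namespace Stmt

/-- **Stub `stub_reflect`** (point reflection of a Dirichlet trial state): `X ↦ (L,…,L) − X` maps
`TrialState N L` to itself, preserves every energy `⟨Ψ, H_v Ψ⟩` (the Laplacian and `∑ v(|x_i − x_j|)` are
reflection invariant) and carries the low slab `{x_{i,k} < s}` onto the top slab `{x_{i,k} > L − s}`. -/
def stub_reflect : Prop :=
  ∀ (N : ℕ) (L : ℝ) (Ψ : Literature.MathematicalPhysics.QuantumManyBody.BoseGas.TrialState N L),
    ∃ Ψ' : Literature.MathematicalPhysics.QuantumManyBody.BoseGas.TrialState N L,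
      (∀ v : ℝ → ℝ≥0∞, Literature.MathematicalPhysics.QuantumManyBody.BoseGas.energy v Ψ' =
        Literature.MathematicalPhysics.QuantumManyBody.BoseGas.energy v Ψ) ∧
      ∀ (i : Fin N) (k : Fin 3) (s : ℝ),
        (∫⁻ X in {X : Literature.MathematicalPhysics.QuantumManyBody.BoseGas.Config N | X i k < s},
            (‖Ψ.ψ X‖₊ : ℝ≥0∞) ^ 2) =
          ∫⁻ X in {X : Literature.MathematicalPhysics.QuantumManyBody.BoseGas.Config N | L - s < X i k},
            (‖Ψ'.ψ X‖₊ : ℝ≥0∞) ^ 2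

/-- **Stub `stub_quadraticCellFloor`** (the explicit convex Lieb–Yngvason floor of the Neumann cell
energies): for `0 < a < ∞` there are `ρ₁ > 0`, `A ≥ 0`, `ℓ₂ > 0` such that for every cell side `ℓ ≥ ℓ₂`
and every `n`, `E₀^Neu(n, ℓ) ≥ (2πa/ℓ³)·min(n,T)(2n − min(n,T)) − A` with `T = ρ₁ℓ³` — quadratic
`2πa n²/ℓ³` (half of LY's `4πa n²/ℓ³`, Thm 2.4 with Neumann b.c. and `1 − CY^{1/17} ≥ 1/2`) up to the dilute
threshold `T`, its tangent continuation above (superadditivity `E(n) ≥ ⌊n/m⌋E(m)`), and the constant `A`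
paying for the finitely many `n` below LY's size threshold. [LSSY2005 (2.52), (2.58)–(2.64)] -/
def stub_quadraticCellFloor : Prop :=
  ∀ (v : ℝ → ℝ≥0∞), Literature.MathematicalPhysics.QuantumManyBody.BoseGas.IsRepulsiveFiniteRange v →
    Literature.MathematicalPhysics.QuantumManyBody.BoseGas.scatteringLength v ≠ ⊤ →
    0 < Literature.MathematicalPhysics.QuantumManyBody.BoseGas.scatteringLength v →
    ∃ ρ₁ A ℓ₂ : ℝ, 0 < ρ₁ ∧ 0 ≤ A ∧ 0 < ℓ₂ ∧ ∀ ℓ : ℝ, ℓ₂ ≤ ℓ → ∀ n : ℕ,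
      ENNReal.ofReal (2 * Real.pi *
          (Literature.MathematicalPhysics.QuantumManyBody.BoseGas.scatteringLength v).toReal / ℓ ^ 3 *
            (min (n : ℝ) (ρ₁ * ℓ ^ 3) * (2 * n - min (n : ℝ) (ρ₁ * ℓ ^ 3))) - A) ≤
        Literature.MathematicalPhysics.QuantumManyBody.BoseGas.neumannGroundStateEnergy v n ℓ

/-- **Stub `stub_convexBracketing`** (macroscopic slab bracketing with a convex cell floor and Ruelle's
tangent — the `slab_le_of_bracketing` pattern with two Jensen steps in place of the linear penalty): with
`K` Neumann cells of side `ℓ` per axis (`Kℓ = L'`), a ramp of width `δ` below the top layer, a slab width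
`s` with `s + δ ≤ ℓ`, a convex floor `g ≤ E₀^Neu(·, ℓ)` with `g(0) ≤ 0`, a subcritical `z` above the
Ruelle density `ρ⋆ = N/(L'+2R)³`, and a trial state of energy `≤ N e(ρ⋆) + E₁`: the top slab mass is at
most some `m̄ ∈ [0, N]` with `K² g(m̄/K²) − m̄ S ≤ E₁ + N(π²/(4δ))²`, `S` the chord slope of `ρ ↦ ρ e(ρ)`
between `ρ⋆` and `z`. [LSSY2005 (2.52)–(2.58); Ruelle1969 §3.5.11] -/
def stub_convexBracketing : Prop :=
  ∀ (v : ℝ → ℝ≥0∞), Literature.MathematicalPhysics.QuantumManyBody.BoseGas.IsRepulsiveFiniteRange v →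
    ∀ (R : ℝ), 0 < R → (∀ r, R < r → v r = 0) →
    ∀ (ρbar : ℝ), ENNReal.ofReal ρbar ≤
      Literature.MathematicalPhysics.QuantumManyBody.BoseGas.criticalDensity v →
    ∀ (N K : ℕ), 0 < N → 0 < K →
    ∀ (L' ℓ δ s : ℝ), 0 < ℓ → (K : ℝ) * ℓ = L' → 0 < δ → s + δ ≤ ℓ →
    ∀ g : ℝ → ℝ, ConvexOn ℝ (Set.Ici (0 : ℝ)) g → g 0 ≤ 0 →
      (∀ n : ℕ, ENNReal.ofReal (g n) ≤
        Literature.MathematicalPhysics.QuantumManyBody.BoseGas.neumannGroundStateEnergy v n ℓ) →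
    ∀ z : ℝ, (N : ℝ) / (L' + 2 * R) ^ 3 < z → z < ρbar →
    ∀ E₁ : ℝ, 0 ≤ E₁ →
    ∀ Φ : Literature.MathematicalPhysics.QuantumManyBody.BoseGas.TrialState N L',
      Literature.MathematicalPhysics.QuantumManyBody.BoseGas.energy v Φ ≤
        ENNReal.ofReal (N *
          (Literature.MathematicalPhysics.QuantumManyBody.BoseGas.limsupEnergyPerParticle v
            (N / (L' + 2 * R) ^ 3)).toReal + E₁) →
    ∀ a : Fin 3, ∃ m : ℝ, 0 ≤ m ∧ m ≤ N ∧
      (∑ j : Fin N, ∫⁻ X in {X : Literature.MathematicalPhysics.QuantumManyBody.BoseGas.Config N |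
          L' - s < X j a}, (‖Φ.ψ X‖₊ : ℝ≥0∞) ^ 2) ≤ ENNReal.ofReal m ∧
      (K : ℝ) ^ 2 * g (m / (K : ℝ) ^ 2) -
          m * ((z * (Literature.MathematicalPhysics.QuantumManyBody.BoseGas.limsupEnergyPerParticle v z).toReal
              - N / (L' + 2 * R) ^ 3 *
                (Literature.MathematicalPhysics.QuantumManyBody.BoseGas.limsupEnergyPerParticle v
                  (N / (L' + 2 * R) ^ 3)).toReal) /
            (z - N / (L' + 2 * R) ^ 3)) ≤
        E₁ + N * (Real.pi ^ 2 / (4 * δ)) ^ 2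

end Stmt

/-! ### Registered stubs -/

/-- stub (M: `Homeomorph`/isometry `X ↦ (L,…,L) − X` is measure preserving on `Config N`, `fderiv` of the
precomposition, `dist` invariance; type = `Stmt.stub_reflect`). -/
theorem stub_reflect : Stmt.stub_reflect := by
  sorry

/-- stub (M–L: LY Thm 2.4 (`LSSY2005_lowerBound_neumann_holds`) below the dilute threshold, superadditivity
(`LSSY2005_superadditivity_holds`) above a quarter of it, template `BoseGas.exists_crowdedCell_penalty`;
type = `Stmt.stub_quadraticCellFloor`). -/
theorem stub_quadraticCellFloor : Stmt.stub_quadraticCellFloor := by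
  sorry

/-- stub (L, the hardest: re-run `BoseGas.slab_le_of_bracketing` — `exists_splitProfile`,
`sum_sum_weight_eq_one`, `sum_sum_floor_mul_weight_le`, `slab_le_sum_card_mul_sum_weight`,
`topLayer_of_weight_ne_zero`, `sum_card_topCells_eq_card`, `card_topCells_le`,
`ofReal_tangent_le_groundStateEnergy` — with Jensen over the `≤ K²` top cells (padding by `g(0) ≤ 0`) and
Jensen over the IMS weights for `max(F, 0)`; type = `Stmt.stub_convexBracketing`). -/
theorem stub_convexBracketing : Stmt.stub_convexBracketing := by
  sorry

example : Stmt.stub_reflect := stub_reflect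
example : Stmt.stub_quadraticCellFloor := stub_quadraticCellFloor
example : Stmt.stub_convexBracketing := stub_convexBracketing

/-! ### Sorry-free glue, I: real analysis of the budget -/

/-- The quadratic-then-tangent profile `q_T(t) = min(t,T)(2t − min(t,T))` equals
`2Tt − T² + ((T − t)₊)²`. [folklore] -/
theorem minTangent_eq (t T : ℝ) :
    min t T * (2 * t - min t T) = 2 * T * t - T ^ 2 + (max (T - t) 0) ^ 2 := by
  rcases le_total t T with h | h
  · rw [min_eq_left h, max_eq_left (by linarith)]; ring
  · rw [min_eq_right h, max_eq_right (by linarith)]; ring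

/-- Convexity inequality for `t ↦ ((T − t)₊)²`. [folklore] -/
theorem sq_posPart_convex {T x y a b : ℝ} (ha : 0 ≤ a) (hb : 0 ≤ b) (hab : a + b = 1) :
    (max (T - (a * x + b * y)) 0) ^ 2 ≤ a * (max (T - x) 0) ^ 2 + b * (max (T - y) 0) ^ 2 := by
  set u := max (T - x) 0 with hu
  set w := max (T - y) 0 with hw
  have hu0 : 0 ≤ u := le_max_right _ _
  have hw0 : 0 ≤ w := le_max_right _ _
  have hux : T - x ≤ u := le_max_left _ _
  have hwy : T - y ≤ w := le_max_left _ _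
  have h1 : max (T - (a * x + b * y)) 0 ≤ a * u + b * w := by
    refine max_le ?_ (by positivity)
    have : T - (a * x + b * y) = a * (T - x) + b * (T - y) := by
      have hb' : b = 1 - a := by linarith
      rw [hb']; ring
    rw [this]
    exact add_le_add (mul_le_mul_of_nonneg_left hux ha) (mul_le_mul_of_nonneg_left hwy hb)
  have h2 : (max (T - (a * x + b * y)) 0) ^ 2 ≤ (a * u + b * w) ^ 2 :=
    pow_le_pow_left₀ (le_max_right _ _) h1 2
  have h3 : (a * u + b * w) ^ 2 ≤ a * u ^ 2 + b * w ^ 2 := by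
    have hid : a * u ^ 2 + b * w ^ 2 - (a * u + b * w) ^ 2 = a * b * (u - w) ^ 2 := by
      have hb' : b = 1 - a := by linarith
      rw [hb']; ring
    nlinarith [mul_nonneg (mul_nonneg ha hb) (sq_nonneg (u - w))]
  exact h2.trans h3

/-- The explicit floor `g(t) = κ·min(t,T)(2t − min(t,T)) − A` is convex on `[0, ∞)` (indeed on `ℝ`)
for `κ ≥ 0`. [folklore] -/
theorem convexOn_quadFloor {κ T A : ℝ} (hκ : 0 ≤ κ) :
    ConvexOn ℝ (Set.Ici (0 : ℝ)) fun t : ℝ => κ * (min t T * (2 * t - min t T)) - A := by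
  refine ⟨convex_Ici 0, fun x _ y _ a b ha hb hab => ?_⟩
  simp only [smul_eq_mul, minTangent_eq]
  have h := mul_le_mul_of_nonneg_left (sq_posPart_convex (T := T) (x := x) (y := y) ha hb hab) hκ
  have hb' : b = 1 - a := by linarith
  rw [hb'] at h ⊢
  nlinarith [h]

/-- The floor vanishes (up to `−A ≤ 0`) at `0`. [folklore] -/
theorem quadFloor_zero {κ T A : ℝ} (hA : 0 ≤ A) (hT : 0 ≤ T) :
    κ * (min (0 : ℝ) T * (2 * 0 - min (0 : ℝ) T)) - A ≤ 0 := by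
  rw [min_eq_left hT]; simp [hA]

/-- **The budget lemma.**  If `g` is convex on `[0,∞)` with `g(0) ≤ 0`, the budget
`K² g(m/K²) − m S ≤ B` (`B ≥ 0`) holds at `m ≥ 0`, and the same expression at `t ≥ 0` EXCEEDS `B`, then
`m < t`: the function `x ↦ K² g(x/K²) − x S` is convex and `≤ 0` at `0`, so it stays `≤ B` on `[0, m]`.
[folklore] -/
theorem lt_of_budget {g : ℝ → ℝ} (hg : ConvexOn ℝ (Set.Ici (0 : ℝ)) g) (hg0 : g 0 ≤ 0) {K S B m t : ℝ}
    (hK : 0 < K) (hm0 : 0 ≤ m) (ht0 : 0 ≤ t) (hB : 0 ≤ B)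
    (hbudget : K ^ 2 * g (m / K ^ 2) - m * S ≤ B) (ht : B < K ^ 2 * g (t / K ^ 2) - t * S) :
    m < t := by
  by_contra hle
  push Not at hle
  have hK2 : 0 < K ^ 2 := by positivity
  rcases hm0.eq_or_lt with hm | hm
  · -- `m = 0` forces `t = 0`, where the expression is `K² g 0 ≤ 0 ≤ B`
    have ht' : t = 0 := le_antisymm (hm ▸ hle) ht0
    rw [ht', zero_div, zero_mul, sub_zero] at ht
    nlinarith [mul_nonpos_iff.2 (Or.inl ⟨hK2.le, hg0⟩)]
  · -- `t = θ m + (1-θ) 0` with `θ = t/m ∈ [0,1]`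
    set θ : ℝ := t / m with hθ
    have hθ0 : 0 ≤ θ := by positivity
    have hθ1 : θ ≤ 1 := (div_le_one hm).2 hle
    have hconv := hg.2 (x := m / K ^ 2) (y := 0) (by positivity : (0 : ℝ) ≤ m / K ^ 2)
      (le_refl (0 : ℝ)) hθ0 (by linarith : 0 ≤ 1 - θ) (by ring)
    simp only [smul_eq_mul, mul_zero, add_zero] at hconv
    have htm : θ * (m / K ^ 2) = t / K ^ 2 := by rw [hθ]; field_simp
    rw [htm] at hconv
    -- `g(t/K²) ≤ θ g(m/K²) + (1-θ) g 0 ≤ θ g(m/K²)`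
    have h1 : K ^ 2 * g (t / K ^ 2) - t * S ≤ θ * (K ^ 2 * g (m / K ^ 2) - m * S) := by
      have htθ : t = θ * m := by rw [hθ]; field_simp
      have htS : t * S = θ * (m * S) := by rw [htθ]; ring
      have h1θ : (0 : ℝ) ≤ 1 - θ := by linarith
      have hmul : K ^ 2 * g (t / K ^ 2) ≤ K ^ 2 * (θ * g (m / K ^ 2)) + K ^ 2 * ((1 - θ) * g 0) := by
        rw [← mul_add]; exact mul_le_mul_of_nonneg_left hconv hK2.le
      have hneg : K ^ 2 * ((1 - θ) * g 0) ≤ 0 :=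
        mul_nonpos_iff.2 (Or.inl ⟨hK2.le, mul_nonpos_iff.2 (Or.inl ⟨h1θ, hg0⟩)⟩)
      rw [htS]
      linarith
    have h2 : θ * (K ^ 2 * g (m / K ^ 2) - m * S) ≤ B := by
      rcases le_or_gt 0 (K ^ 2 * g (m / K ^ 2) - m * S) with hpos | hneg
      · calc θ * (K ^ 2 * g (m / K ^ 2) - m * S) ≤ 1 * (K ^ 2 * g (m / K ^ 2) - m * S) :=
              mul_le_mul_of_nonneg_right hθ1 hpos
          _ ≤ B := by linarith
      · exact (mul_nonpos_iff.2 (Or.inl ⟨hθ0, hneg.le⟩)).trans hB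
    linarith

/-! ### Sorry-free glue, II: the shell is covered by the six face slabs -/

/-- `1_S · F = 1_S F`. [folklore] -/
theorem indicator_one_mul {α : Type*} (S : Set α) (F : α → ℝ≥0∞) (X : α) :
    S.indicator (fun _ => (1 : ℝ≥0∞)) X * F X = S.indicator F X := by
  by_cases hX : X ∈ S <;> simp [hX]

/-- Pointwise: outside the inner cube `(εL, L−εL)³` some coordinate is `≤ εL < s` or `≥ L−εL > L−s`.
[folklore] -/
theorem indicator_shell_le {L ε s : ℝ} (hs : ε * L < s) {N : ℕ} (X : Config N) (i : Fin N) :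
    {x : EuclideanSpace ℝ (Fin 3) | ∀ j, x j ∈ Set.Ioo (ε * L) (L - ε * L)}ᶜ.indicator
        (fun _ => (1 : ℝ≥0∞)) (X i) ≤
      ∑ k : Fin 3, ({X : Config N | X i k < s}.indicator (fun _ => (1 : ℝ≥0∞)) X +
        {X : Config N | L - s < X i k}.indicator (fun _ => (1 : ℝ≥0∞)) X) := by
  by_cases hX : X i ∈ {x : EuclideanSpace ℝ (Fin 3) | ∀ j, x j ∈ Set.Ioo (ε * L) (L - ε * L)}
  · rw [Set.indicator_of_notMem (Set.notMem_compl_iff.2 hX)]; positivity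
  · rw [Set.indicator_of_mem (Set.mem_compl hX)]
    simp only [Set.mem_setOf_eq, not_forall] at hX
    obtain ⟨k, hk⟩ := hX
    refine le_trans ?_ (Finset.single_le_sum (fun k _ => by positivity) (Finset.mem_univ k))
    rw [Set.mem_Ioo, not_and_or, not_lt, not_lt] at hk
    rcases hk with hk | hk
    · have hmem : X ∈ {X : Config N | X i k < s} := by simp only [Set.mem_setOf_eq]; linarith
      rw [Set.indicator_of_mem hmem]; exact le_self_add
    · have hmem : X ∈ {X : Config N | L - s < X i k} := by simp only [Set.mem_setOf_eq]; linarith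
      rw [Set.indicator_of_mem hmem]; exact le_add_self

/-- **Six faces.** The shell mass is at most the sum of the six face-slab masses of width `s > εL`.
[folklore] -/
theorem shellMass_le_faces {N : ℕ} {L ε s : ℝ} (hs : ε * L < s) (Ψ : TrialState N L) :
    (∑ i : Fin N, ∫⁻ X, {x : EuclideanSpace ℝ (Fin 3) | ∀ j, x j ∈ Set.Ioo (ε * L) (L - ε * L)}ᶜ.indicator
        (fun _ => (1 : ℝ≥0∞)) (X i) * (‖Ψ.ψ X‖₊ : ℝ≥0∞) ^ 2) ≤
      ∑ k : Fin 3, ((∑ i : Fin N, ∫⁻ X in {X : Config N | X i k < s}, (‖Ψ.ψ X‖₊ : ℝ≥0∞) ^ 2) +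
        ∑ i : Fin N, ∫⁻ X in {X : Config N | L - s < X i k}, (‖Ψ.ψ X‖₊ : ℝ≥0∞) ^ 2) := by
  have hF : Measurable fun X : Config N => (‖Ψ.ψ X‖₊ : ℝ≥0∞) ^ 2 :=
    measurable_normSq Ψ.contDiff.continuous
  have hlow : ∀ (i : Fin N) (k : Fin 3), MeasurableSet {X : Config N | X i k < s} := fun i k =>
    measurableSet_lt (by fun_prop) measurable_const
  have htop : ∀ (i : Fin N) (k : Fin 3), MeasurableSet {X : Config N | L - s < X i k} := fun i k =>
    measurableSet_lt measurable_const (by fun_prop)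
  calc (∑ i : Fin N, ∫⁻ X, {x : EuclideanSpace ℝ (Fin 3) | ∀ j, x j ∈ Set.Ioo (ε * L) (L - ε * L)}ᶜ.indicator
        (fun _ => (1 : ℝ≥0∞)) (X i) * (‖Ψ.ψ X‖₊ : ℝ≥0∞) ^ 2)
      ≤ ∑ i : Fin N, ∫⁻ X, ∑ k : Fin 3,
          ({X : Config N | X i k < s}.indicator (fun X => (‖Ψ.ψ X‖₊ : ℝ≥0∞) ^ 2) X +
            {X : Config N | L - s < X i k}.indicator (fun X => (‖Ψ.ψ X‖₊ : ℝ≥0∞) ^ 2) X) := by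
        refine Finset.sum_le_sum fun i _ => lintegral_mono fun X => ?_
        calc _ ≤ (∑ k : Fin 3, ({X : Config N | X i k < s}.indicator (fun _ => (1 : ℝ≥0∞)) X +
              {X : Config N | L - s < X i k}.indicator (fun _ => (1 : ℝ≥0∞)) X)) *
              (‖Ψ.ψ X‖₊ : ℝ≥0∞) ^ 2 := mul_le_mul_left (indicator_shell_le hs X i) _
          _ = _ := by
              rw [Finset.sum_mul]
              refine Finset.sum_congr rfl fun k _ => ?_
              rw [add_mul, indicator_one_mul _ (fun X => (‖Ψ.ψ X‖₊ : ℝ≥0∞) ^ 2),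
                indicator_one_mul _ (fun X => (‖Ψ.ψ X‖₊ : ℝ≥0∞) ^ 2)]
    _ = ∑ i : Fin N, ∑ k : Fin 3, ((∫⁻ X in {X : Config N | X i k < s}, (‖Ψ.ψ X‖₊ : ℝ≥0∞) ^ 2) +
          ∫⁻ X in {X : Config N | L - s < X i k}, (‖Ψ.ψ X‖₊ : ℝ≥0∞) ^ 2) := by
        refine Finset.sum_congr rfl fun i _ => ?_
        calc _ = ∑ k : Fin 3, ∫⁻ X, ({X : Config N | X i k < s}.indicator
              (fun X => (‖Ψ.ψ X‖₊ : ℝ≥0∞) ^ 2) X +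
              {X : Config N | L - s < X i k}.indicator (fun X => (‖Ψ.ψ X‖₊ : ℝ≥0∞) ^ 2) X) :=
              lintegral_finsetSum Finset.univ fun k _ =>
                (hF.indicator (hlow i k)).add (hF.indicator (htop i k))
          _ = _ := by
              refine Finset.sum_congr rfl fun k _ => ?_
              rw [lintegral_add_left (hF.indicator (hlow i k)), lintegral_indicator (hlow i k),
                lintegral_indicator (htop i k)]
    _ = _ := by
        rw [Finset.sum_comm]
        exact Finset.sum_congr rfl fun k _ => Finset.sum_add_distrib

/-- The expected number of particles in any one-body region is at most `N`. [folklore] -/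
theorem shellMass_le {N : ℕ} {L : ℝ} (Ψ : TrialState N L) (A : Set (EuclideanSpace ℝ (Fin 3))) :
    (∑ i : Fin N, ∫⁻ X, A.indicator (fun _ => (1 : ℝ≥0∞)) (X i) * (‖Ψ.ψ X‖₊ : ℝ≥0∞) ^ 2) ≤
      (N : ℝ≥0∞) := by
  calc (∑ i : Fin N, ∫⁻ X, A.indicator (fun _ => (1 : ℝ≥0∞)) (X i) * (‖Ψ.ψ X‖₊ : ℝ≥0∞) ^ 2)
      ≤ ∑ _i : Fin N, ∫⁻ X, (‖Ψ.ψ X‖₊ : ℝ≥0∞) ^ 2 := by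
        refine Finset.sum_le_sum fun i _ => lintegral_mono fun X => ?_
        calc A.indicator (fun _ => (1 : ℝ≥0∞)) (X i) * (‖Ψ.ψ X‖₊ : ℝ≥0∞) ^ 2
            ≤ 1 * (‖Ψ.ψ X‖₊ : ℝ≥0∞) ^ 2 := by
              gcongr
              exact Set.indicator_le_self' (fun _ _ => zero_le_one) (X i)
          _ = _ := one_mul _
    _ = N := by simp [Ψ.norm_eq]

/-- Six equal slab bounds add up. [folklore] -/
theorem sum_three_le {b : ℝ} (hb : 0 ≤ b) {f g : Fin 3 → ℝ≥0∞} (hf : ∀ k, f k ≤ ENNReal.ofReal b)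
    (hg : ∀ k, g k ≤ ENNReal.ofReal b) : ∑ k : Fin 3, (f k + g k) ≤ ENNReal.ofReal (6 * b) := by
  calc ∑ k : Fin 3, (f k + g k) ≤ ∑ _k : Fin 3, ENNReal.ofReal (2 * b) := by
        refine Finset.sum_le_sum fun k _ => ?_
        rw [show 2 * b = b + b by ring, ENNReal.ofReal_add hb hb]
        exact add_le_add (hf k) (hg k)
    _ = ENNReal.ofReal (6 * b) := by
        rw [Finset.sum_const, Finset.card_univ, Fintype.card_fin, nsmul_eq_mul, Nat.cast_ofNat,
          ← ENNReal.ofReal_ofNat 3, ← ENNReal.ofReal_mul (by norm_num)]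
        ring_nf

/-! ### The crux's conclusion at fixed `(v, C, ε, ρ)` -/

/-- The conclusion of `BecShellMass` for one potential, constant, shell fraction and density. -/
def ShellBound (v : ℝ → ℝ≥0∞) (C ε ρ : ℝ) : Prop :=
  ∀ᶠ N : ℕ in Filter.atTop, ∃ δ : ENNReal, 0 < δ ∧
    ∀ Ψ : Literature.MathematicalPhysics.QuantumManyBody.BoseGas.TrialState N
        (Literature.MathematicalPhysics.QuantumManyBody.BoseGas.sideLength ρ N),
      Literature.MathematicalPhysics.QuantumManyBody.BoseGas.energy v Ψ ≤
          Literature.MathematicalPhysics.QuantumManyBody.BoseGas.groundStateEnergy v N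
            (Literature.MathematicalPhysics.QuantumManyBody.BoseGas.sideLength ρ N) + δ →
        ∑ i : Fin N, ∫⁻ X, {x : EuclideanSpace ℝ (Fin 3) | ∀ j, x j ∈ Set.Ioo
            (ε * Literature.MathematicalPhysics.QuantumManyBody.BoseGas.sideLength ρ N)
            (Literature.MathematicalPhysics.QuantumManyBody.BoseGas.sideLength ρ N -
              ε * Literature.MathematicalPhysics.QuantumManyBody.BoseGas.sideLength ρ N)}ᶜ.indicator
            (fun _ => (1 : ENNReal)) (X i) * (‖Ψ.ψ X‖₊ : ENNReal) ^ 2 ≤ ENNReal.ofReal (C * ε * N)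

/-- The trivial regime `Cε ≥ 1`: the shell holds at most all `N` particles. [folklore] -/
theorem shellBound_of_one_le {v : ℝ → ℝ≥0∞} {C ε ρ : ℝ} (hCε : 1 ≤ C * ε) : ShellBound v C ε ρ := by
  refine Filter.Eventually.of_forall fun N => ⟨1, one_pos, fun Ψ _ => ?_⟩
  refine (shellMass_le Ψ _).trans ?_
  rw [← ENNReal.ofReal_natCast]
  exact ENNReal.ofReal_le_ofReal (by nlinarith [(Nat.cast_nonneg N : (0 : ℝ) ≤ N)])

/-! ### Sorry-free glue, III: the free branch `a = 0` -/

/-- Bookkeeping for one free slab of width `s = 2εL`: `(4π²s³/(3L³) + 2ε)N + 2L²/(3π²) ≤ 16εN` once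
`L ≥ 1/(ερ)` (`N = ρL³`, `ε < 1/4`, `π ≤ 4`). [folklore] -/
theorem free_arith {ε ρ L N : ℝ} (hε : 0 < ε) (hε4 : ε < 1 / 4) (hρ : 0 < ρ) (hL : 0 < L)
    (hL1 : 1 / (ε * ρ) ≤ L) (hN : N = ρ * L ^ 3) :
    (4 * Real.pi ^ 2 * (2 * ε * L) ^ 3 / (3 * L ^ 3) + 2 * ε) * N + 2 * L ^ 2 / (3 * Real.pi ^ 2) ≤
      16 * ε * N := by
  have hπ4 := Real.pi_le_four
  have hπ3 := Real.pi_gt_three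
  have hπ0 := Real.pi_pos
  have h1 : 4 * Real.pi ^ 2 * (2 * ε * L) ^ 3 / (3 * L ^ 3) = 32 / 3 * Real.pi ^ 2 * ε ^ 3 := by
    field_simp; ring
  have h2 : 32 / 3 * Real.pi ^ 2 * ε ^ 3 ≤ 11 * ε := by
    have hπ2 : Real.pi ^ 2 ≤ 16 := by nlinarith
    have hε2 : ε ^ 2 ≤ 1 / 16 := by nlinarith
    calc 32 / 3 * Real.pi ^ 2 * ε ^ 3 = 32 / 3 * (Real.pi ^ 2 * ε ^ 2) * ε := by ring
      _ ≤ 32 / 3 * (16 * (1 / 16)) * ε := by gcongr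
      _ ≤ 11 * ε := by linarith
  have hN0 : 0 < N := by rw [hN]; positivity
  have h3 : 2 * L ^ 2 / (3 * Real.pi ^ 2) ≤ ε * N := by
    have hεL : 1 ≤ ε * ρ * L := by
      rw [div_le_iff₀ (by positivity)] at hL1; linarith
    have hπ2 : 9 ≤ Real.pi ^ 2 := by nlinarith
    have h4 : L ^ 2 ≤ ε * ρ * L ^ 3 := by nlinarith [pow_pos hL 2]
    have h5 : 0 ≤ ε * ρ * L ^ 3 := by positivity
    rw [div_le_iff₀ (by positivity), hN]
    nlinarith [mul_nonneg (sub_nonneg.2 hπ2) h5]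
  rw [h1]
  nlinarith

/-- **The free branch.**  For `a = 0` the potential is invisible, near-minimisers have kinetic energy
`≤ 3N(π/L)²(1+ε) + 1` for large `L`, and `slab_le_of_kinetic_excess` (top slabs) plus the reflection
(low slabs) bound the six face slabs of width `2εL` by `16εN` each. -/
theorem shellBound_free (hrefl : Stmt.stub_reflect) {v : ℝ → ℝ≥0∞} (hv : IsRepulsiveFiniteRange v)
    (ha0 : scatteringLength v = 0) {ε : ℝ} (hε : 0 < ε) (hε4 : ε < 1 / 4) {ρ : ℝ} (hρ : 0 < ρ) :
    ShellBound v 100 ε ρ := by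
  obtain ⟨R₀, hR₀⟩ := hv.2
  have hae : ∀ᵐ x : Space, v ‖x‖ = 0 := LSSY2005_zeroScatteringLength_holds v R₀ hv.1 hR₀ ha0
  obtain ⟨L₀, hL₀, Hfree⟩ := groundStateEnergy_zero_le_of_ge hε
  have hE1 : ∀ᶠ N : ℕ in atTop, L₀ ≤ sideLength ρ N :=
    (tendsto_sideLength_atTop hρ).eventually_ge_atTop _
  have hE2 : ∀ᶠ N : ℕ in atTop, 1 / (ε * ρ) ≤ sideLength ρ N :=
    (tendsto_sideLength_atTop hρ).eventually_ge_atTop _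
  unfold ShellBound
  filter_upwards [hE1, hE2, eventually_gt_atTop 0] with N hN1 hN2 hN0
  set L := sideLength ρ N with hL
  refine ⟨1, one_pos, fun Ψ hΨ => ?_⟩
  have hLpos : 0 < L := sideLength_pos_of_pos hρ hN0
  have hNr : (0 : ℝ) < N := Nat.cast_pos.2 hN0
  have hL3 : L ^ 3 = N / ρ := sideLength_pow_three hρ N
  have hNρ : (N : ℝ) = ρ * L ^ 3 := by rw [hL3]; field_simp
  have hT : ∀ Φ : TrialState N L, energy v Φ ≤ groundStateEnergy v N L + 1 →
      ∫⁻ X, kineticDensity Φ.ψ X ≤ ENNReal.ofReal (3 * N * (Real.pi / L) ^ 2 * (1 + ε)) + 1 := by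
    intro Φ hΦ
    rw [← energy_eq_lintegral_kineticDensity hv.1 hae Φ]
    refine hΦ.trans (add_le_add ?_ le_rfl)
    rw [groundStateEnergy_eq_zero_potential hv.1 hae]
    exact Hfree L hN1 N
  set s : ℝ := 2 * ε * L with hs
  have hs0 : 0 < s := by positivity
  have hsL : s ≤ L := by rw [hs]; nlinarith
  have hεs : ε * L < s := by rw [hs]; linarith [mul_pos hε hLpos]
  have hb : (4 * Real.pi ^ 2 * s ^ 3 / (3 * L ^ 3) + 2 * ε) * N + 2 * L ^ 2 / (3 * Real.pi ^ 2) ≤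
      16 * ε * N := free_arith hε hε4 hρ hLpos hN2 hNρ
  have htop : ∀ Φ : TrialState N L, energy v Φ ≤ groundStateEnergy v N L + 1 → ∀ k : Fin 3,
      (∑ j : Fin N, ∫⁻ X in {X : Config N | L - s < X j k}, (‖Φ.ψ X‖₊ : ℝ≥0∞) ^ 2) ≤
        ENNReal.ofReal (16 * ε * N) := fun Φ hΦ k =>
    (slab_le_of_kinetic_excess hLpos Φ hε.le (hT Φ hΦ) k hs0 hsL).trans (ENNReal.ofReal_le_ofReal hb)
  obtain ⟨Ψ', hΨ'e, hΨ'r⟩ := hrefl N L Ψ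
  have hΨ' : energy v Ψ' ≤ groundStateEnergy v N L + 1 := by rw [hΨ'e v]; exact hΨ
  have hlow : ∀ k : Fin 3, (∑ j : Fin N, ∫⁻ X in {X : Config N | X j k < s},
      (‖Ψ.ψ X‖₊ : ℝ≥0∞) ^ 2) ≤ ENNReal.ofReal (16 * ε * N) := by
    intro k
    calc _ = ∑ j : Fin N, ∫⁻ X in {X : Config N | L - s < X j k}, (‖Ψ'.ψ X‖₊ : ℝ≥0∞) ^ 2 :=
          Finset.sum_congr rfl fun j _ => hΨ'r j k s
      _ ≤ _ := htop Ψ' hΨ' k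
  calc _ ≤ _ := shellMass_le_faces hεs Ψ
    _ ≤ ENNReal.ofReal (6 * (16 * ε * N)) := sum_three_le (by positivity) hlow (htop Ψ hΨ)
    _ ≤ ENNReal.ofReal (100 * ε * N) := ENNReal.ofReal_le_ofReal (by nlinarith)

/-! ### Sorry-free glue, IV: the interacting branch `a > 0` -/

/-- **The budget at `t⋆ = C′N/K` beats `B`.**  With `N = ρK³ℓ³`, `t⋆/K² = C′ρℓ³ ≤ ρ₁ℓ³` (quadratic
regime, from `C′ρ ≤ ρ₁`), `S ≤ πaρC′` and `(5/2)εK ≤ 1`: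
`K² g(t⋆/K²) − t⋆S ≥ P − K²A ≥ M₀N − K²A > M₀N/4 + 1 + N D²`, where `P = πaC′²ρ²K²ℓ³` and
`M₀N = (5/2)εK · P`. [folklore] -/
theorem interacting_budget {a C' ρ₁ A ε ρ K ℓ S ND Nr t : ℝ} (ha : 0 < a) (hC' : 0 < C')
    (hε : 0 < ε) (hρ : 0 < ρ) (hK : 0 < K) (hℓ : 0 < ℓ) (hεK : 5 / 2 * ε * K ≤ 1)
    (hρC : C' * ρ ≤ ρ₁) (hS : S ≤ Real.pi * a * ρ * C') (hN : Nr = ρ * K ^ 3 * ℓ ^ 3)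
    (htK2 : t / K ^ 2 = C' * ρ * ℓ ^ 3) (htK : t = C' * ρ * K ^ 2 * ℓ ^ 3)
    (hND : ND ≤ 5 / 2 * Real.pi * ε * a * ρ * C' ^ 2 * Nr / 8)
    (hKA : 1 + K ^ 2 * A ≤ 5 / 2 * Real.pi * ε * a * ρ * C' ^ 2 * Nr / 4) :
    5 / 2 * Real.pi * ε * a * ρ * C' ^ 2 * Nr / 4 + 1 + ND <
      K ^ 2 * (2 * Real.pi * a / ℓ ^ 3 * (min (t / K ^ 2) (ρ₁ * ℓ ^ 3) *
        (2 * (t / K ^ 2) - min (t / K ^ 2) (ρ₁ * ℓ ^ 3))) - A) - t * S := by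
  rw [htK2]
  have hℓ3 : 0 < ℓ ^ 3 := pow_pos hℓ 3
  have hmin : min (C' * ρ * ℓ ^ 3) (ρ₁ * ℓ ^ 3) = C' * ρ * ℓ ^ 3 :=
    min_eq_left (mul_le_mul_of_nonneg_right hρC hℓ3.le)
  rw [hmin]
  set P : ℝ := Real.pi * a * C' ^ 2 * ρ ^ 2 * K ^ 2 * ℓ ^ 3 with hP
  have hP0 : 0 < P := by positivity
  have hexpr : K ^ 2 * (2 * Real.pi * a / ℓ ^ 3 * (C' * ρ * ℓ ^ 3 * (2 * (C' * ρ * ℓ ^ 3) -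
      C' * ρ * ℓ ^ 3)) - A) = 2 * P - K ^ 2 * A := by
    rw [hP]; field_simp; ring
  have htS : t * S ≤ P := by
    have ht0 : 0 ≤ t := by rw [htK]; positivity
    calc t * S ≤ t * (Real.pi * a * ρ * C') := mul_le_mul_of_nonneg_left hS ht0
      _ = P := by rw [htK, hP]; ring
  set M : ℝ := 5 / 2 * Real.pi * ε * a * ρ * C' ^ 2 * Nr with hM
  have hM0 : 0 < M := by rw [hM, hN]; positivity
  have hMP : M ≤ P := by
    have h1 : M = 5 / 2 * ε * K * P := by rw [hM, hN, hP]; ring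
    rw [h1]; nlinarith
  rw [hexpr]
  linarith

/-- The IMS ramp term: `N (π²/(4δ_r))² ≤ M₀N/8` for `δ_r = εL/2` once `L ≥ max 1 (2π⁴/(ε²M₀))`.
[folklore] -/
theorem ims_arith {ε L M₀ Nr : ℝ} (hε : 0 < ε) (hM : 0 < M₀) (hN : 0 ≤ Nr) (hL1 : 1 ≤ L)
    (hL2 : 2 * Real.pi ^ 4 / (ε ^ 2 * M₀) ≤ L) :
    Nr * (Real.pi ^ 2 / (4 * (ε * L / 2))) ^ 2 ≤ M₀ * Nr / 8 := by
  have hL0 : 0 < L := by linarith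
  have hL2' : 2 * Real.pi ^ 4 / (ε ^ 2 * M₀) ≤ L ^ 2 := hL2.trans (by nlinarith)
  rw [div_le_iff₀ (by positivity)] at hL2'
  have hid : (Real.pi ^ 2 / (4 * (ε * L / 2))) ^ 2 = Real.pi ^ 4 / (4 * (ε ^ 2 * L ^ 2)) := by
    field_simp; ring
  rw [hid]
  have h1 : Real.pi ^ 4 / (4 * (ε ^ 2 * L ^ 2)) ≤ M₀ / 8 := by
    rw [div_le_iff₀ (by positivity)]; nlinarith
  calc Nr * (Real.pi ^ 4 / (4 * (ε ^ 2 * L ^ 2))) ≤ Nr * (M₀ / 8) := mul_le_mul_of_nonneg_left h1 hN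
    _ = M₀ * Nr / 8 := by ring

/-- The size-threshold offsets of the `K² ≤ 4/(25ε²)` top cells: `1 + K²A ≤ M₀N/4` once
`N ≥ (4/M₀)(1 + 4A/(25ε²))`. [folklore] -/
theorem offset_arith {ε K A M₀ Nr : ℝ} (hε : 0 < ε) (hK : 0 < K) (hA : 0 ≤ A) (hM : 0 < M₀)
    (hεK : 5 / 2 * ε * K ≤ 1) (hN : 4 / M₀ * (1 + 4 * A / (25 * ε ^ 2)) ≤ Nr) :
    1 + K ^ 2 * A ≤ M₀ * Nr / 4 := by
  have hK2 : K ^ 2 ≤ 4 / (25 * ε ^ 2) := by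
    rw [le_div_iff₀ (by positivity)]
    nlinarith [mul_nonneg (sub_nonneg.2 hεK) (by positivity : (0 : ℝ) ≤ 1 + 5 / 2 * ε * K)]
  have hKA : K ^ 2 * A ≤ 4 / (25 * ε ^ 2) * A := mul_le_mul_of_nonneg_right hK2 hA
  have h4 : 4 * A / (25 * ε ^ 2) = 4 / (25 * ε ^ 2) * A := by ring
  rw [h4, div_mul_eq_mul_div, div_le_iff₀ hM] at hN
  nlinarith

set_option maxHeartbeats 800000 in
/-- **The interacting branch, with `ρ₀` independent of `ε`.** -/
theorem shellBound_interacting (hrefl : Stmt.stub_reflect) (hqcf : Stmt.stub_quadraticCellFloor)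
    (hcb : Stmt.stub_convexBracketing) {v : ℝ → ℝ≥0∞} (hv : IsRepulsiveFiniteRange v)
    (hapos : 0 < scatteringLength v) :
    ∃ C : ℝ, 0 < C ∧ ∃ ρ₀ : ℝ, 0 < ρ₀ ∧ ∀ ε : ℝ, 0 < ε → ε < 1 / 4 →
      ∀ ρ : ℝ, 0 < ρ → ρ < ρ₀ → ShellBound v C ε ρ := by
  obtain ⟨R, hR, hv0⟩ := hv.exists_pos_range
  have hfin : scatteringLength v ≠ ⊤ := scatteringLength_ne_top_of_finiteRange hv0
  set a₀ : ℝ := (scatteringLength v).toReal with ha₀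
  have ha₀pos : 0 < a₀ := ENNReal.toReal_pos hapos.ne' hfin
  -- the convex cell floor
  obtain ⟨ρ₁, A, ℓ₂, hρ₁, hA, hℓ₂, Hfloor⟩ := hqcf v hv hfin hapos
  -- a subcritical cap
  set ρbar : ℝ := 1 / (2 * (1 + R) ^ 3) with hρbar
  have hρbar0 : 0 < ρbar := by positivity
  have hsmall : ρbar * (1 + R) ^ 3 < 1 := by
    rw [hρbar, div_mul_eq_mul_div, one_mul, div_lt_one (by positivity)]
    nlinarith [pow_pos (by linarith : 0 < 1 + R) 3]
  have hcap : ENNReal.ofReal ρbar ≤ criticalDensity v :=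
    ofReal_le_criticalDensity hv.1 hv0 hR hρbar0 hsmall
  -- the Dyson–LSSY upper bound on `e⁺`
  obtain ⟨Cu, ρu, hCu, hρu, Hup⟩ := eventually_groundStateEnergy_le_dyson hv0 hv.1 hfin hapos
  have hebound : ∀ y : ℝ, 0 < y → y < ρu → y * a₀ ^ 3 ≤ 1 →
      (limsupEnergyPerParticle v y).toReal ≤ 4 * Real.pi * y * a₀ * (1 + Cu) := by
    intro y hy hyu hya
    have hC0 : 0 ≤ 4 * Real.pi * y * a₀ * (1 + Cu * (y * a₀ ^ 3) ^ ((1 : ℝ) / 3)) := by positivity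
    have h1 := limsupEnergyPerParticle_le_of_eventually hC0 (Hup y hy hyu)
    have h2 := ENNReal.toReal_mono ENNReal.ofReal_ne_top h1
    rw [ENNReal.toReal_ofReal hC0] at h2
    refine h2.trans ?_
    have h3 : (y * a₀ ^ 3) ^ ((1 : ℝ) / 3) ≤ 1 := Real.rpow_le_one (by positivity) hya (by norm_num)
    have h4 : Cu * (y * a₀ ^ 3) ^ ((1 : ℝ) / 3) ≤ Cu := by nlinarith
    have : 0 ≤ 4 * Real.pi * y * a₀ := by positivity
    nlinarith
  set C' : ℝ := 16 * (1 + Cu) with hC'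
  have hC'0 : 0 < C' := by positivity
  have hC'16 : 16 ≤ C' := by rw [hC']; linarith
  -- the density threshold: INDEPENDENT of `ε`
  set ρ₀ : ℝ := min (min (ρbar / 4) (ρu / 4)) (min (1 / (2 * a₀ ^ 3)) (ρ₁ / C')) with hρ₀
  have hρ₀pos : 0 < ρ₀ := by positivity
  refine ⟨30 * C', by positivity, ρ₀, hρ₀pos, fun ε hε hε4 ρ hρ hρlt => ?_⟩
  have hρ1 : ρ < ρbar / 4 := hρlt.trans_le ((min_le_left _ _).trans (min_le_left _ _))
  have hρ2 : ρ < ρu / 4 := hρlt.trans_le ((min_le_left _ _).trans (min_le_right _ _))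
  have hρ3 : ρ < 1 / (2 * a₀ ^ 3) := hρlt.trans_le ((min_le_right _ _).trans (min_le_left _ _))
  have hρ4 : ρ < ρ₁ / C' := hρlt.trans_le ((min_le_right _ _).trans (min_le_right _ _))
  have hρC : C' * ρ ≤ ρ₁ := by rw [lt_div_iff₀ hC'0] at hρ4; linarith
  have h2ρbar : 2 * ρ < ρbar := by linarith
  have hρc : ENNReal.ofReal ρ < criticalDensity v :=
    lt_of_lt_of_le ((ENNReal.ofReal_lt_ofReal_iff hρbar0).2 (by linarith)) hcap
  -- the trivial regime `30 C' ε ≥ 1`; otherwise `ε ≤ 1/5`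
  by_cases hCε : 1 ≤ 30 * C' * ε
  · exact shellBound_of_one_le hCε
  have hε5 : ε ≤ 1 / 5 := by
    push Not at hCε
    linarith [mul_le_mul_of_nonneg_right hC'16 hε.le]
  -- Dyson at `2ρ`
  set e : ℝ → ℝ := fun x => (limsupEnergyPerParticle v x).toReal with he
  have he2ρ : e (2 * ρ) ≤ 8 * Real.pi * ρ * a₀ * (1 + Cu) := by
    have hya : 2 * ρ * a₀ ^ 3 ≤ 1 := by
      rw [lt_div_iff₀ (by positivity)] at hρ3; linarith
    have h := hebound (2 * ρ) (by linarith) (by linarith) hya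
    have : 4 * Real.pi * (2 * ρ) * a₀ * (1 + Cu) = 8 * Real.pi * ρ * a₀ * (1 + Cu) := by ring
    linarith
  -- thermodynamic inputs at `ρ`
  have heρT : limsupEnergyPerParticle v ρ ≠ ⊤ :=
    (limsupEnergyPerParticle_lt_top_of_lt_criticalDensity hρ hρc).ne
  have hT := tendsto_energyPerParticleDirichlet_of_lt_criticalDensity hv hρ hρc
  have hcont := continuousAt_toReal_limsupEnergyPerParticle hv hρ hρc
  -- the margin per particle and the near-minimality slack
  set M₀ : ℝ := 5 / 2 * Real.pi * ε * a₀ * ρ * C' ^ 2 with hM₀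
  have hM₀0 : 0 < M₀ := by positivity
  set ε₁ : ℝ := M₀ / 8 with hε₁
  have hε₁0 : 0 < ε₁ := by positivity
  -- (E1) the energies at density `ρ` are eventually `≤ N (e(ρ) + ε₁)`
  have hE1 : ∀ᶠ N : ℕ in atTop, groundStateEnergy v N (sideLength ρ N) ≤
      ENNReal.ofReal ((e ρ + ε₁) * N) := by
    have hlt : limsupEnergyPerParticle v ρ < limsupEnergyPerParticle v ρ + ENNReal.ofReal ε₁ :=
      ENNReal.lt_add_right heρT (by simpa using hε₁0)
    filter_upwards [(tendsto_order.1 hT).2 _ hlt, eventually_gt_atTop 0] with N hN hN0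
    have hN0' : (N : ℝ≥0∞) ≠ 0 := Nat.cast_ne_zero.2 hN0.ne'
    unfold energyPerParticleDirichlet at hN
    rw [ENNReal.div_lt_iff (Or.inl hN0') (Or.inl (ENNReal.natCast_ne_top N))] at hN
    refine hN.le.trans (le_of_eq ?_)
    rw [ENNReal.ofReal_mul (by positivity), ENNReal.ofReal_natCast, ENNReal.ofReal_add
      ENNReal.toReal_nonneg hε₁0.le, ENNReal.ofReal_toReal heρT]
  -- (E2) continuity of `e` at `ρ`
  obtain ⟨η, hη, hηe⟩ : ∃ η > 0, ∀ x, dist x ρ < η → dist (e x) (e ρ) < ε₁ :=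
    Metric.continuousAt_iff.1 hcont ε₁ hε₁0
  -- (E3) the Ruelle densities are eventually within `η` of `ρ`
  have hE3 : ∀ᶠ N : ℕ in atTop, ρ - η < (N : ℝ) / ((1 + 0 / N) * sideLength ρ N + 2 * R) ^ 3 :=
    (tendsto_order.1 (tendsto_window_density hρ le_rfl hR.le)).1 _ (by linarith)
  -- (E5)–(E6) sizes
  have hE5 : ∀ᶠ N : ℕ in atTop, max 1 (max (ℓ₂ / ε) (2 * Real.pi ^ 4 / (ε ^ 2 * M₀))) ≤
      sideLength ρ N := (tendsto_sideLength_atTop hρ).eventually_ge_atTop _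
  have hE6 : ∀ᶠ N : ℕ in atTop, 4 / M₀ * (1 + 4 * A / (25 * ε ^ 2)) ≤ (N : ℝ) :=
    tendsto_natCast_atTop_atTop.eventually_ge_atTop _
  unfold ShellBound
  filter_upwards [hE1, hE3, hE5, hE6, eventually_gt_atTop 0] with N hN1 hN3 hN5 hN6 hN0
  set L := sideLength ρ N with hL
  refine ⟨1, one_pos, fun Ψ hΨ => ?_⟩
  have hNr : (0 : ℝ) < N := Nat.cast_pos.2 hN0
  have hLpos : 0 < L := sideLength_pos_of_pos hρ hN0
  have hL1 : 1 ≤ L := (le_max_left _ _).trans hN5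
  have hLℓ₂ : ℓ₂ / ε ≤ L := ((le_max_left _ _).trans (le_max_right _ _)).trans hN5
  have hLπ : 2 * Real.pi ^ 4 / (ε ^ 2 * M₀) ≤ L :=
    ((le_max_right _ _).trans (le_max_right _ _)).trans hN5
  have hL3 : L ^ 3 = N / ρ := sideLength_pow_three hρ N
  have hNρ : (N : ℝ) = ρ * L ^ 3 := by rw [hL3]; field_simp
  -- geometry: slab `s = 2εL`, ramp `δ_r = εL/2`, cell scale `ℓ₀ = s + δ_r`
  set s : ℝ := 2 * ε * L with hs
  set δr : ℝ := ε * L / 2 with hδr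
  set ℓ₀ : ℝ := 5 / 2 * ε * L with hℓ₀
  have hℓ₀pos : 0 < ℓ₀ := by positivity
  have h2ℓ₀ : 2 * ℓ₀ ≤ L := by
    have h1 : ε * L ≤ 1 / 5 * L := mul_le_mul_of_nonneg_right hε5 hLpos.le
    rw [hℓ₀]; linarith
  obtain ⟨hK, hℓlo, hℓhi⟩ := floor_cells hℓ₀pos h2ℓ₀
  set K : ℕ := ⌊L / ℓ₀⌋₊ with hKdef
  set ℓ : ℝ := L / K with hℓdef
  have hKr : (0 : ℝ) < K := Nat.cast_pos.2 hK
  have hℓpos : 0 < ℓ := lt_of_lt_of_le hℓ₀pos hℓlo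
  have hKℓ : (K : ℝ) * ℓ = L := by rw [hℓdef]; field_simp
  have hεK : 5 / 2 * ε * K ≤ 1 := by
    have h1 : (K : ℝ) * ℓ₀ ≤ L := by rw [← hKℓ]; exact mul_le_mul_of_nonneg_left hℓlo hKr.le
    rw [hℓ₀] at h1
    exact le_of_mul_le_mul_right (by linarith) hLpos
  have hεK' : 1 ≤ 5 * ε * K := by
    have h1 : L ≤ (K : ℝ) * (2 * ℓ₀) := by rw [← hKℓ]; exact mul_le_mul_of_nonneg_left hℓhi hKr.le
    rw [hℓ₀] at h1
    exact le_of_mul_le_mul_right (by linarith) hLpos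
  have hNK : (N : ℝ) = ρ * K ^ 3 * ℓ ^ 3 := by rw [hNρ, ← hKℓ]; ring
  have hℓ₂ℓ : ℓ₂ ≤ ℓ := by
    have h1 : ℓ₂ ≤ ℓ₀ := by
      rw [div_le_iff₀ hε] at hLℓ₂; rw [hℓ₀]; linarith [mul_pos hε hLpos]
    exact h1.trans hℓlo
  have hsδ : s + δr ≤ ℓ := by
    have h1 : s + δr = ℓ₀ := by rw [hs, hδr, hℓ₀]; ring
    rw [h1]; exact hℓlo
  have hδr0 : 0 < δr := by positivity
  have hεs : ε * L < s := by rw [hs]; linarith [mul_pos hε hLpos]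
  -- the floor
  set g : ℝ → ℝ := fun t => 2 * Real.pi * a₀ / ℓ ^ 3 *
    (min t (ρ₁ * ℓ ^ 3) * (2 * t - min t (ρ₁ * ℓ ^ 3))) - A with hgdef
  have hgc : ConvexOn ℝ (Set.Ici (0 : ℝ)) g := convexOn_quadFloor (by positivity)
  have hg0 : g 0 ≤ 0 := quadFloor_zero hA (by positivity)
  have hgfloor : ∀ n : ℕ, ENNReal.ofReal (g n) ≤ neumannGroundStateEnergy v n ℓ := fun n =>
    Hfloor ℓ hℓ₂ℓ n
  -- densities and the chord slope
  set ρs : ℝ := N / (L + 2 * R) ^ 3 with hρs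
  have hρsρ : ρs ≤ ρ := by
    have hle : L ^ 3 ≤ (L + 2 * R) ^ 3 := pow_le_pow_left₀ hLpos.le (by linarith) 3
    rw [hρs, div_le_iff₀ (by positivity), hNρ]
    exact mul_le_mul_of_nonneg_left hle hρ.le
  have hρslo : ρ - η < ρs := by
    have h1 := hN3
    simp only [zero_div, add_zero, one_mul] at h1
    exact h1
  have heρs : e ρ ≤ e ρs + ε₁ := by
    have hd : dist ρs ρ < η := by
      rw [Real.dist_eq, abs_lt]; constructor <;> linarith
    have h1 := hηe ρs hd
    rw [Real.dist_eq, abs_lt] at h1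
    linarith
  set z : ℝ := 2 * ρ with hz
  have hρsz : ρs < z := by rw [hz]; linarith
  have h2ρz : z < ρbar := by rw [hz]; linarith
  set S : ℝ := (z * e z - ρs * e ρs) / (z - ρs) with hS
  have hSle : S ≤ Real.pi * a₀ * ρ * C' := by
    have heS0 : 0 ≤ e ρs := ENNReal.toReal_nonneg
    have hez0 : 0 ≤ e z := ENNReal.toReal_nonneg
    have hρs0 : 0 ≤ ρs := by positivity
    have h1 : S ≤ z * e z / (z - ρs) := by
      rw [hS]
      exact div_le_div_of_nonneg_right (by linarith [mul_nonneg hρs0 heS0]) (by linarith)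
    have h2 : z * e z / (z - ρs) ≤ 2 * e z := by
      rw [div_le_iff₀ (by linarith)]
      have h4 : 0 ≤ e z * (z - 2 * ρs) := mul_nonneg hez0 (by linarith)
      linarith
    have h3 : 2 * e z ≤ Real.pi * a₀ * ρ * C' := by
      have hez : e z = e (2 * ρ) := by rw [hz]
      have h4 : 2 * (8 * Real.pi * ρ * a₀ * (1 + Cu)) = Real.pi * a₀ * ρ * C' := by rw [hC']; ring
      linarith [he2ρ]
    linarith
  -- the energy hypothesis of the bracketing stub
  set E₁ : ℝ := 2 * ε₁ * N + 1 with hE₁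
  have hE₁0 : 0 ≤ E₁ := by positivity
  have henergy : ∀ Φ : TrialState N L, energy v Φ ≤ groundStateEnergy v N L + 1 →
      energy v Φ ≤ ENNReal.ofReal (N * e ρs + E₁) := by
    intro Φ hΦ
    have heρs0 : 0 ≤ e ρs := ENNReal.toReal_nonneg
    have hle : (e ρ + ε₁) * N ≤ N * (e ρs + 2 * ε₁) := by
      have h1 := mul_le_mul_of_nonneg_right heρs hNr.le
      have h2 : 0 ≤ ε₁ * N := by positivity
      linarith
    calc energy v Φ ≤ groundStateEnergy v N L + 1 := hΦ
      _ ≤ ENNReal.ofReal ((e ρ + ε₁) * N) + 1 := add_le_add hN1 le_rfl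
      _ ≤ ENNReal.ofReal (N * (e ρs + 2 * ε₁)) + 1 := add_le_add (ENNReal.ofReal_le_ofReal hle) le_rfl
      _ = ENNReal.ofReal (N * e ρs + E₁) := by
          rw [hE₁, show (N : ℝ) * e ρs + (2 * ε₁ * N + 1) = N * (e ρs + 2 * ε₁) + 1 by ring,
            ENNReal.ofReal_add (by positivity) zero_le_one, ENNReal.ofReal_one]
  -- the budget beats `B` at `t⋆ = C′N/K`
  set t : ℝ := C' * N / K with ht
  have ht0 : 0 ≤ t := by positivity
  have htK2 : t / (K : ℝ) ^ 2 = C' * ρ * ℓ ^ 3 := by rw [ht, hNK]; field_simp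
  have htK : t = C' * ρ * (K : ℝ) ^ 2 * ℓ ^ 3 := by rw [ht, hNK]; field_simp
  set ND : ℝ := N * (Real.pi ^ 2 / (4 * δr)) ^ 2 with hND
  have hND0 : 0 ≤ ND := by positivity
  have hNDle : ND ≤ 5 / 2 * Real.pi * ε * a₀ * ρ * C' ^ 2 * N / 8 := by
    have h1 : ND ≤ M₀ * N / 8 := ims_arith hε hM₀0 hNr.le hL1 hLπ
    rw [hM₀] at h1; exact h1
  have hKA : 1 + (K : ℝ) ^ 2 * A ≤ 5 / 2 * Real.pi * ε * a₀ * ρ * C' ^ 2 * N / 4 := by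
    have h1 : 1 + (K : ℝ) ^ 2 * A ≤ M₀ * N / 4 := offset_arith hε hKr hA hM₀0 hεK hN6
    rw [hM₀] at h1; exact h1
  have hB : E₁ + N * (Real.pi ^ 2 / (4 * δr)) ^ 2 =
      5 / 2 * Real.pi * ε * a₀ * ρ * C' ^ 2 * N / 4 + 1 + ND := by
    rw [hE₁, hε₁, hM₀, hND]; ring
  have hB0 : 0 ≤ 5 / 2 * Real.pi * ε * a₀ * ρ * C' ^ 2 * N / 4 + 1 + ND := by positivity
  have key : 5 / 2 * Real.pi * ε * a₀ * ρ * C' ^ 2 * N / 4 + 1 + ND <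
      (K : ℝ) ^ 2 * g (t / (K : ℝ) ^ 2) - t * S :=
    interacting_budget ha₀pos hC'0 hε hρ hKr hℓpos hεK hρC hSle hNK htK2 htK hNDle hKA
  have htle : t ≤ 5 * C' * ε * N := by
    rw [ht, div_le_iff₀ hKr]
    have h1 := mul_le_mul_of_nonneg_left hεK' (mul_pos hC'0 hNr).le
    linarith
  -- one top slab
  have htop : ∀ Φ : TrialState N L, energy v Φ ≤ groundStateEnergy v N L + 1 → ∀ a : Fin 3,
      (∑ j : Fin N, ∫⁻ X in {X : Config N | L - s < X j a}, (‖Φ.ψ X‖₊ : ℝ≥0∞) ^ 2) ≤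
        ENNReal.ofReal (5 * C' * ε * N) := by
    intro Φ hΦ a
    obtain ⟨m, hm0, -, hslab, hbudget⟩ := hcb v hv R hR hv0 ρbar hcap N K hN0 hK L ℓ δr s hℓpos
      hKℓ hδr0 hsδ g hgc hg0 hgfloor z hρsz h2ρz E₁ hE₁0 Φ (henergy Φ hΦ) a
    have hbudget' : (K : ℝ) ^ 2 * g (m / (K : ℝ) ^ 2) - m * S ≤
        5 / 2 * Real.pi * ε * a₀ * ρ * C' ^ 2 * N / 4 + 1 + ND := by
      rw [← hB]; exact hbudget
    have hlt : m < t := lt_of_budget hgc hg0 hKr hm0 ht0 hB0 hbudget' key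
    exact hslab.trans (ENNReal.ofReal_le_ofReal (by linarith))
  -- low slabs by reflection, and the six faces
  obtain ⟨Ψ', hΨ'e, hΨ'r⟩ := hrefl N L Ψ
  have hΨ' : energy v Ψ' ≤ groundStateEnergy v N L + 1 := by rw [hΨ'e v]; exact hΨ
  have hlow : ∀ k : Fin 3, (∑ j : Fin N, ∫⁻ X in {X : Config N | X j k < s},
      (‖Ψ.ψ X‖₊ : ℝ≥0∞) ^ 2) ≤ ENNReal.ofReal (5 * C' * ε * N) := by
    intro k
    calc _ = ∑ j : Fin N, ∫⁻ X in {X : Config N | L - s < X j k}, (‖Ψ'.ψ X‖₊ : ℝ≥0∞) ^ 2 :=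
          Finset.sum_congr rfl fun j _ => hΨ'r j k s
      _ ≤ _ := htop Ψ' hΨ' k
  calc _ ≤ _ := shellMass_le_faces hεs Ψ
    _ ≤ ENNReal.ofReal (6 * (5 * C' * ε * N)) := sum_three_le (by positivity) hlow (htop Ψ hΨ)
    _ = ENNReal.ofReal (30 * C' * ε * N) := by ring_nf

/-! ### Both branches, and the composition -/

/-- **`BecShellMass` with `ρ₀` independent of `ε`** (the strengthening S⁺₁ recorded OPEN in
`Disproof.lean` §3), from the three stubs. -/
theorem becShellMass_uniform (hrefl : Stmt.stub_reflect) (hqcf : Stmt.stub_quadraticCellFloor)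
    (hcb : Stmt.stub_convexBracketing) (v : ℝ → ℝ≥0∞) (hv : IsRepulsiveFiniteRange v) :
    ∃ C : ℝ, 0 < C ∧ ∃ ρ₀ : ℝ, 0 < ρ₀ ∧ ∀ ε : ℝ, 0 < ε → ε < 1 / 4 →
      ∀ ρ : ℝ, 0 < ρ → ρ < ρ₀ → ShellBound v C ε ρ := by
  by_cases ha0 : scatteringLength v = 0
  · exact ⟨100, by norm_num, 1, one_pos, fun ε hε hε4 ρ hρ _ => shellBound_free hrefl hv ha0 hε hε4 hρ⟩
  · exact shellBound_interacting hrefl hqcf hcb hv (pos_iff_ne_zero.2 ha0)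

/-- **Composition**: the three stubs imply the crux. -/
theorem becShellMass_of_stubs (hrefl : Stmt.stub_reflect) (hqcf : Stmt.stub_quadraticCellFloor)
    (hcb : Stmt.stub_convexBracketing) : BECInfraredBound.BecShellMass := by
  intro v hv
  obtain ⟨C, hC, ρ₀, hρ₀, H⟩ := becShellMass_uniform hrefl hqcf hcb v hv
  exact ⟨C, hC, fun ε hε hε4 => ⟨ρ₀, hρ₀, fun ρ hρ hρ0 => H ε hε hε4 ρ hρ hρ0⟩⟩

/-- **The crux BY NAME** from the registered stubs. -/
theorem BecShellMass_of : BECInfraredBound.BecShellMass :=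
  becShellMass_of_stubs stub_reflect stub_quadraticCellFloor stub_convexBracketing

end Summit.AtomisticToContinuum.BoseEinsteinCondensation.Cruxes.BecShellMass.RuelleBracketing

end
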